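import Summits.BirchSwinnertonDyer.BirchSwinnertonDyer.Theorems.ManinLocalTwoThreeManinPrimeToAdditiveFiveLeReducibleThirteenDegreeUp
import HarnessLib

/-!
# Route `ManinLocalTwoThree`, residual crux C5 `ManinPrimeToAdditiveFiveLe`
# (stmt-BirchSwinnertonDyer-22969), line `upper_anchor`: the v5 stub `DegreeUp13Red` SPLIT BY NAME —
# the cell's open direction law E-an-33 `CommutingOrbitDiscrDirectionR 13` plus «no flip» on the
# `W[13]`-reducible unstarred locus

Lead seat bsd-line-ml23-c5-p1 (gen 3); sequel of `…ReducibleThirteenDegreeUp` (p618203), whose §2 proves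
RED(13♯) ⟸ Edixhoven's printed Kodaira statement ∧ `DegreeUp13Red` («along `W ⊗ 13` from an unstarred
`W[13]`-reducible optimal curve the optimal modular degree is multiplied by `13`», the registered stub
`stub_degreeUp13Red` of skeleton v5). Here the degree law is tied to the cell's NAMED open law:

* `degreeUp13Red_of_discrDirectionR_of_noFlip`: `DegreeUp13Red` ⟸ `CommutingOrbitDiscrDirectionR 13` (E-an-33,
  decl of record; conjecture leaf `Rank1Residual/ManinAdditive/CommutingOrbitDiscrDirection.lean`: on a commuting
  optimal `13`-pair «degree up ⇒ discriminant up»; census 667 706/667 706 commuting odd-`p` rows) ∧ `NoFlip13Red`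
  («the lattice-optimal curve of the class of `W ⊗ 13` is a model of `W ⊗ 13`» for `W` on the RED(13♯) locus —
  the reducible analogue of the PROVED `pStar_optimal_orbit_commutes_of_irreducible`).
* `noFlip13Red_of_degreeUp13Red`: conversely `DegreeUp13Red` ⟹ `NoFlip13Red` (numerics of the trichotomy).

So the honest open content of RED(13♯) after gen 3 is: E-an-33 at `p = 13` on pairs with an unstarred
`W[13]`-reducible member (= Edixhoven 1991 §4 «only case 2», open for potentially ordinary reduction) and the
commuting of optimality with `⊗ 13` there (flips contradict Manin ∧ Stevens by Dokchitser–Dokchitser 2015, see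
the parent file's docstring; none in Cremona's range). Conditional results; nothing here proves C5 or BSD.

References: [EdixhovenManin1991] §4; [DokchitserDokchitser2015] Table 1, §5; [Stevens1989] §2.
-/

set_option autoImplicit false
-- the Theorems namespace of this sub repeats the summit name by design (D-0017 nested layout)
set_option linter.dupNamespace false

noncomputable section

open scoped Classical NumberField

namespace Summit.BirchSwinnertonDyer.BirchSwinnertonDyer.Theorems

open WeierstrassCurve IsDedekindDomain NumberField Rat.HeightOneSpectrum
  Literature.NumberTheory.EllipticCurves Literature.NumberTheory.EllipticCurves.ModularForms
  Literature.NumberTheory.EllipticCurves.Rank1Residual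
  Summit.BirchSwinnertonDyer.Rank1Residual.ManinAdditive
  Summit.BirchSwinnertonDyer.Rank1Residual.Additive

/-! ## The degree law = the cell's direction law E-an-33 at `13` + «no flip» on the reducible locus -/

/-- **`DegreeUp13Red` ⟸ E-an-33 `CommutingOrbitDiscrDirectionR 13` ∧ `NoFlip13Red`.** The cell's OPEN direction
law on commuting optimal `13`-pairs (conjecture leaf `CommutingOrbitDiscrDirectionR`, decl of record of E-an-33:
«degree up ⇒ discriminant up»; census 667 706/667 706 commuting odd-`p` rows) together with «optimality commutes
with `⊗ 13` on the RED(13♯) locus» (`hNF`: the lattice-optimal curve of the class of `W ⊗ 13` IS a model of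
`W ⊗ 13` — the `W[13]`-reducible analogue of the cell's PROVED `pStar_optimal_orbit_commutes_of_irreducible`)
give the degree law (§2 of the parent file): `hNF` supplies `u`; in the trichotomy, case (ii) `13·deg′ = deg` is the direction
law applied to the REVERSED pair `(W′, W)` (`exists_smul_quadraticTwist_eq_of_smul_quadraticTwist_eq`), which
would force `ord₁₃ Δ_min(W) = ord₁₃ Δ_min(W′) + 6 ≥ 6`, against `≤ 4`; case (iii) `deg′ = deg` never commutes
(`pStar_optimal_not_commuting_of_modularDegree_eq`). So the typed residual of RED(13♯) reads: Edixhoven's printed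
Kodaira statement ∧ E-an-33 at `p = 13` (on pairs with an unstarred reducible member) ∧ no flip. Conditional
result. [cite: EdixhovenManin1991, §4 (p. 13, last paragraph)] -/
theorem degreeUp13Red_of_discrDirectionR_of_noFlip
    (hDir : CommutingOrbitDiscrDirectionR 13)
    (hNF : exists_isNewformOf →
      ∀ (W : WeierstrassCurve ℚ) [W.IsElliptic] [W.IsGloballyMinimal] [NeZero (W.conductorNorm ℤ)]
        (D : ModularParametrizationData W (W.conductorNorm ℤ)),
        IsLatticeOptimal D → ∀ p : ℕ, p.Prime → p = 13 → p ^ 2 ∣ W.conductorNorm ℤ →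
        ¬ (∃ (W' : WeierstrassCurve ℚ) (q : ℕ), W'.IsElliptic ∧ W'.IsGloballyMinimal ∧ q.Prime ∧
            q ≠ 2 ∧ q ^ 2 ∣ W.conductorNorm ℤ ∧
            IsIsogenous W (W'.quadraticTwist (((-1 : ℤ) ^ (q / 2) * q : ℤ) : ℚ)) ∧
            ¬ q ^ 2 ∣ W'.conductorNorm ℤ) →
        ¬ (∃ (W' : WeierstrassCurve ℚ) (d : ℤ), W'.IsElliptic ∧ W'.IsGloballyMinimal ∧
            (d = -1 ∨ d = 2 ∨ d = -2) ∧ 2 ^ 2 ∣ W.conductorNorm ℤ ∧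
            IsIsogenous W (W'.quadraticTwist (d : ℚ)) ∧ ¬ 2 ^ 2 ∣ W'.conductorNorm ℤ) →
        ¬ W.HasIrreducibleModPGaloisRep p →
        padicValInt p W.minimalDiscriminantInt ≤ 4 →
        (∃ (L : Type) (_ : Field L) (_ : NumberField L) (_ : IsCyclotomicExtension {p} ℚ L)
            (F : IntermediateField ℚ L),
            ∀ w : HeightOneSpectrum (𝓞 F), (p : 𝓞 F) ∈ w.asIdeal →
              (W.baseChange F).HasGoodReductionAt w ∧ (W.baseChange F).HasUnitRootAt w) →
        p ∣ D.modularDegree →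
        500000 < W.conductorNorm ℤ →
        ∀ (W' : WeierstrassCurve ℚ) [W'.IsElliptic] [W'.IsGloballyMinimal] [NeZero (W'.conductorNorm ℤ)]
          (D' : ModularParametrizationData W' (W'.conductorNorm ℤ)),
          IsLatticeOptimal D' → W'.conductorNorm ℤ = W.conductorNorm ℤ →
          IsIsogenous (W.quadraticTwist (((-1 : ℤ) ^ (p / 2) * p : ℤ) : ℚ)) W' →
          ∃ u : VariableChange ℚ, u • W.quadraticTwist ((((-1 : ℤ) ^ (p / 2) * p : ℤ)) : ℚ) = W') :
    exists_isNewformOf →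
      ∀ (W : WeierstrassCurve ℚ) [W.IsElliptic] [W.IsGloballyMinimal] [NeZero (W.conductorNorm ℤ)]
        (D : ModularParametrizationData W (W.conductorNorm ℤ)),
        IsLatticeOptimal D → ∀ p : ℕ, p.Prime → p = 13 → p ^ 2 ∣ W.conductorNorm ℤ →
        ¬ (∃ (W' : WeierstrassCurve ℚ) (q : ℕ), W'.IsElliptic ∧ W'.IsGloballyMinimal ∧ q.Prime ∧
            q ≠ 2 ∧ q ^ 2 ∣ W.conductorNorm ℤ ∧
            IsIsogenous W (W'.quadraticTwist (((-1 : ℤ) ^ (q / 2) * q : ℤ) : ℚ)) ∧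
            ¬ q ^ 2 ∣ W'.conductorNorm ℤ) →
        ¬ (∃ (W' : WeierstrassCurve ℚ) (d : ℤ), W'.IsElliptic ∧ W'.IsGloballyMinimal ∧
            (d = -1 ∨ d = 2 ∨ d = -2) ∧ 2 ^ 2 ∣ W.conductorNorm ℤ ∧
            IsIsogenous W (W'.quadraticTwist (d : ℚ)) ∧ ¬ 2 ^ 2 ∣ W'.conductorNorm ℤ) →
        ¬ W.HasIrreducibleModPGaloisRep p →
        padicValInt p W.minimalDiscriminantInt ≤ 4 →
        (∃ (L : Type) (_ : Field L) (_ : NumberField L) (_ : IsCyclotomicExtension {p} ℚ L)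
            (F : IntermediateField ℚ L),
            ∀ w : HeightOneSpectrum (𝓞 F), (p : 𝓞 F) ∈ w.asIdeal →
              (W.baseChange F).HasGoodReductionAt w ∧ (W.baseChange F).HasUnitRootAt w) →
        p ∣ D.modularDegree →
        500000 < W.conductorNorm ℤ →
        ∀ (W' : WeierstrassCurve ℚ) [W'.IsElliptic] [W'.IsGloballyMinimal] [NeZero (W'.conductorNorm ℤ)]
          (D' : ModularParametrizationData W' (W'.conductorNorm ℤ)),
          IsLatticeOptimal D' → W'.conductorNorm ℤ = W.conductorNorm ℤ →
          IsIsogenous (W.quadraticTwist (((-1 : ℤ) ^ (p / 2) * p : ℤ) : ℚ)) W' →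
          D'.modularDegree = p * D.modularDegree := by
  intro hnf W _ _ _ D hD p hp hp13 hpN hodd hdy hred hlow hGo hdeg h500 W' _ _ _ D' hD' hNN hiso
  subst hp13
  haveI : Fact (Nat.Prime 13) := ⟨hp⟩
  obtain ⟨u, hu⟩ := hNF hnf W D hD 13 hp rfl hpN hodd hdy hred hlow hGo hdeg h500 W' D' hD' hNN hiso
  rcases pStar_optimal_orbit_trichotomy_full hp (by norm_num) W W' D D' hD hD' hpN hNN hiso with
    ⟨-, hdeg₁, -⟩ | ⟨-, hdeg₂, -⟩ | hdeg₃
  · exact hdeg₁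
  · -- the reversed pair `(W′, W)`: the direction law would put `W` ABOVE `W′`
    exfalso
    have hd0 : ((((-1 : ℤ) ^ (13 / 2) * 13 : ℤ)) : ℚ) ≠ 0 := by norm_num
    obtain ⟨C, hC⟩ := exists_smul_quadraticTwist_eq_of_smul_quadraticTwist_eq hd0 u hu
    have hpN' : 13 ^ 2 ∣ W'.conductorNorm ℤ := by rw [hNN]; exact hpN
    have hΔ := hDir hp (by norm_num) W' W C D' D hD' hD hpN' hNN.symm hC hdeg₂.symm
    omega
  · exact absurd hu (pStar_optimal_not_commuting_of_modularDegree_eq hp (by norm_num) D D' hpN hNN hD hD'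
      hdeg₃ u)

/-- **Conversely `DegreeUp13Red` ⟹ `NoFlip13Red`:** if the optimal degree goes up by `13` along `W ⊗ 13 ∼ W′`,
the orbit commutes (trichotomy: cases (ii)/(iii) are numerically excluded, case (i) carries the isomorphism).
Unconditional. [cite: EdixhovenManin1991, §4] -/
theorem noFlip13Red_of_degreeUp13Red
    (hUp : exists_isNewformOf →
      ∀ (W : WeierstrassCurve ℚ) [W.IsElliptic] [W.IsGloballyMinimal] [NeZero (W.conductorNorm ℤ)]
        (D : ModularParametrizationData W (W.conductorNorm ℤ)),
        IsLatticeOptimal D → ∀ p : ℕ, p.Prime → p = 13 → p ^ 2 ∣ W.conductorNorm ℤ →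
        ¬ (∃ (W' : WeierstrassCurve ℚ) (q : ℕ), W'.IsElliptic ∧ W'.IsGloballyMinimal ∧ q.Prime ∧
            q ≠ 2 ∧ q ^ 2 ∣ W.conductorNorm ℤ ∧
            IsIsogenous W (W'.quadraticTwist (((-1 : ℤ) ^ (q / 2) * q : ℤ) : ℚ)) ∧
            ¬ q ^ 2 ∣ W'.conductorNorm ℤ) →
        ¬ (∃ (W' : WeierstrassCurve ℚ) (d : ℤ), W'.IsElliptic ∧ W'.IsGloballyMinimal ∧
            (d = -1 ∨ d = 2 ∨ d = -2) ∧ 2 ^ 2 ∣ W.conductorNorm ℤ ∧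
            IsIsogenous W (W'.quadraticTwist (d : ℚ)) ∧ ¬ 2 ^ 2 ∣ W'.conductorNorm ℤ) →
        ¬ W.HasIrreducibleModPGaloisRep p →
        padicValInt p W.minimalDiscriminantInt ≤ 4 →
        (∃ (L : Type) (_ : Field L) (_ : NumberField L) (_ : IsCyclotomicExtension {p} ℚ L)
            (F : IntermediateField ℚ L),
            ∀ w : HeightOneSpectrum (𝓞 F), (p : 𝓞 F) ∈ w.asIdeal →
              (W.baseChange F).HasGoodReductionAt w ∧ (W.baseChange F).HasUnitRootAt w) →
        p ∣ D.modularDegree →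
        500000 < W.conductorNorm ℤ →
        ∀ (W' : WeierstrassCurve ℚ) [W'.IsElliptic] [W'.IsGloballyMinimal] [NeZero (W'.conductorNorm ℤ)]
          (D' : ModularParametrizationData W' (W'.conductorNorm ℤ)),
          IsLatticeOptimal D' → W'.conductorNorm ℤ = W.conductorNorm ℤ →
          IsIsogenous (W.quadraticTwist (((-1 : ℤ) ^ (p / 2) * p : ℤ) : ℚ)) W' →
          D'.modularDegree = p * D.modularDegree) :
    exists_isNewformOf →
      ∀ (W : WeierstrassCurve ℚ) [W.IsElliptic] [W.IsGloballyMinimal] [NeZero (W.conductorNorm ℤ)]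
        (D : ModularParametrizationData W (W.conductorNorm ℤ)),
        IsLatticeOptimal D → ∀ p : ℕ, p.Prime → p = 13 → p ^ 2 ∣ W.conductorNorm ℤ →
        ¬ (∃ (W' : WeierstrassCurve ℚ) (q : ℕ), W'.IsElliptic ∧ W'.IsGloballyMinimal ∧ q.Prime ∧
            q ≠ 2 ∧ q ^ 2 ∣ W.conductorNorm ℤ ∧
            IsIsogenous W (W'.quadraticTwist (((-1 : ℤ) ^ (q / 2) * q : ℤ) : ℚ)) ∧
            ¬ q ^ 2 ∣ W'.conductorNorm ℤ) →
        ¬ (∃ (W' : WeierstrassCurve ℚ) (d : ℤ), W'.IsElliptic ∧ W'.IsGloballyMinimal ∧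
            (d = -1 ∨ d = 2 ∨ d = -2) ∧ 2 ^ 2 ∣ W.conductorNorm ℤ ∧
            IsIsogenous W (W'.quadraticTwist (d : ℚ)) ∧ ¬ 2 ^ 2 ∣ W'.conductorNorm ℤ) →
        ¬ W.HasIrreducibleModPGaloisRep p →
        padicValInt p W.minimalDiscriminantInt ≤ 4 →
        (∃ (L : Type) (_ : Field L) (_ : NumberField L) (_ : IsCyclotomicExtension {p} ℚ L)
            (F : IntermediateField ℚ L),
            ∀ w : HeightOneSpectrum (𝓞 F), (p : 𝓞 F) ∈ w.asIdeal →
              (W.baseChange F).HasGoodReductionAt w ∧ (W.baseChange F).HasUnitRootAt w) →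
        p ∣ D.modularDegree →
        500000 < W.conductorNorm ℤ →
        ∀ (W' : WeierstrassCurve ℚ) [W'.IsElliptic] [W'.IsGloballyMinimal] [NeZero (W'.conductorNorm ℤ)]
          (D' : ModularParametrizationData W' (W'.conductorNorm ℤ)),
          IsLatticeOptimal D' → W'.conductorNorm ℤ = W.conductorNorm ℤ →
          IsIsogenous (W.quadraticTwist (((-1 : ℤ) ^ (p / 2) * p : ℤ) : ℚ)) W' →
          ∃ u : VariableChange ℚ, u • W.quadraticTwist ((((-1 : ℤ) ^ (p / 2) * p : ℤ)) : ℚ) = W' := by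
  intro hnf W _ _ _ D hD p hp hp13 hpN hodd hdy hred hlow hGo hdeg h500 W' _ _ _ D' hD' hNN hiso
  subst hp13
  haveI : Fact (Nat.Prime 13) := ⟨hp⟩
  have hup := hUp hnf W D hD 13 hp rfl hpN hodd hdy hred hlow hGo hdeg h500 W' D' hD' hNN hiso
  have hpos : 0 < D.modularDegree := D.deg_pos
  rcases pStar_optimal_orbit_trichotomy_full hp (by norm_num) W W' D D' hD hD' hpN hNN hiso with
    ⟨hu, -, -⟩ | ⟨-, hdeg₂, -⟩ | hdeg₃
  · exact hu
  · omega
  · omega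

end Summit.BirchSwinnertonDyer.BirchSwinnertonDyer.Theorems

end
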